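import Mathlib
import Summits.Ventures.HodgeRepro.Tier4.Line1.RTFSetting

/-!
# Tier4/Line1/IsotypicC2 — (C2) IN THE ISOTYPIC WORDING: intertwiners and isomorphisms of invariant subspaces,
MULTIPLICITY ONE of a displayed family of constituents, the `e`-fixed functor, and the displayed hypothesis shape
«multiplicity one + the fixed functor reflects isomorphism» ⇒ the (C2) field `hnon` of the Hecke block

Blind re-derivation cell `pub-hodge-repro`, Tier 4 (README §9–§10), seat t4-L1-p2 (gen 4), LINE L1; the record row
(C2) of the line table in the isotypic wording (t4-plan-1 g2 S14090, t4-crit-2 g4 S13974), stated as a DISPLAYED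
hypothesis shape for t4-L1-p5 g3's `HeckeBlockW.ofIdempotent` / `IdempotentData` (HeckeBlockIdempotent, S14118:
field `hnon : ∀ i j, i ≠ j → IsEmpty (W i ≃ₗ[H] W j)`).  Target tree path
`lean/Summits/Ventures/HodgeRepro/Tier4/Line1/IsotypicC2.lean`.  Imports only RTFSetting (`Setting`, `IsTest`, `R`,
`Invariant`, `IsInvariantSubspace`); this module does NOT import p5's block modules — its binders are p5's, copied
(`Vb`, `e`, `hVb`, `tst`, `htst`, `hact`, `idx`, `W`, `hW`; only `[Ring H] [Module H Vb]` are needed here), so the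
consumer instantiates by name.  0 print.

WHAT THIS IS.  (C2) of the line table says that the constituents `W i = τ (idx i) ∩ Vb` of the finite Hecke block
`Vb` (the `R(e)`-fixed continuous invariant functions, `e` an idempotent self-adjoint test function) are pairwise
non-isomorphic `H`-modules.  The ISOTYPIC WORDING of record: the `τ m` are the constituents of the discrete spectrum,
pairwise NON-ISOMORPHIC representations (multiplicity one — a printed/route-derived DATA statement about `U(W)`,
displayed here as `MultiplicityOne`), and the `e`-fixed functor `τ ↦ τ ∩ Vb` REFLECTS isomorphism on the
constituents it does not kill (Bernstein: `π ↦ π^K` is injective on the irreducibles with `π^K ≠ 0`, displayed here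
as `ReflectsIso`).  This module fixes the VOCABULARY in the tree's own terms — an intertwiner of two invariant
subspaces of `C(G(k)\G)` is a map of functions, linear on the source, commuting with right translation and with
every `R(f)` (`IsIntertwiner`); an isomorphism of representations is a pair of mutually inverse intertwiners
(`IsIsoRep`, `IsoRep`; reflexive, symmetric, transitive) — and proves: the FORWARD functor
(`exists_linearEquiv_of_isIsoRep`: an isomorphism of constituents restricts to an `H`-linear isomorphism of the
fixed blocks, the `H`-action being `r • ψ = R (tst r) ψ`), `injective_idx_of_multiplicityOne` (multiplicity one of the
displayed family forces distinct indices to be distinct constituents), and the ASSEMBLY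
`hnon_of_multiplicityOne_of_reflectsIso`: the two displayed clauses give exactly the field `hnon`.

WHAT IS NOT CLAIMED.  Neither displayed clause is proved here: multiplicity one of the discrete spectrum of `U(W)` is
DATA of the route (not a kernel cut), and `ReflectsIso` is the Bernstein direction (the fixed-vector functor is
fully faithful on the representations generated by their fixed vectors) — in the tree's topological model
(`IsIrreducible` = `L²(DG)`-density) it needs the continuity of `R(e)` on the closure, not done here.  Nothing here
says anything about the status of the Hodge conjecture for CM abelian varieties, which is NOT proved (HC_CM is NOT
proved by anyone in this repository).
-/

set_option autoImplicit false

noncomputable section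

namespace Summit.Ventures.HodgeRepro.Tier4.Line1

open MeasureTheory Topology

namespace RTF

namespace Setting

variable {G : Type} [Group G] [TopologicalSpace G] [IsTopologicalGroup G] [MeasurableSpace G] [BorelSpace G]
  (S : Setting G)

section Intertwiner

/-- **an intertwiner from `V` to `V'`**: a map of functions sending `V` into `V'`, additive and `ℂ`-homogeneous on
`V`, commuting with right translation and with every `R(f)` (`f` a test function) on `V`. -/
structure IsIntertwiner (V V' : Set (G → ℂ)) (Φ : (G → ℂ) → (G → ℂ)) : Prop where
  /-- `Φ` sends `V` into `V'` -/
  maps : ∀ ψ ∈ V, Φ ψ ∈ V'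
  /-- additive on `V` -/
  add : ∀ ψ ∈ V, ∀ ψ' ∈ V, Φ (fun x => ψ x + ψ' x) = fun x => Φ ψ x + Φ ψ' x
  /-- `ℂ`-homogeneous on `V` -/
  smul : ∀ ψ ∈ V, ∀ c : ℂ, Φ (fun x => c * ψ x) = fun x => c * Φ ψ x
  /-- commutes with right translation on `V` -/
  right : ∀ ψ ∈ V, ∀ g : G, Φ (fun x => ψ (x * g)) = fun x => Φ ψ (x * g)
  /-- commutes with `R(f)` on `V` for every test function `f` -/
  conv : ∀ ψ ∈ V, ∀ f : G → ℂ, IsTest f → Φ (S.R f ψ) = S.R f (Φ ψ)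

/-- **an isomorphism of representations `V ≅ V'`**: a pair of mutually inverse intertwiners. -/
structure IsIsoRep (V V' : Set (G → ℂ)) (Φ Ψ : (G → ℂ) → (G → ℂ)) : Prop where
  /-- the forward intertwiner -/
  toFun : S.IsIntertwiner V V' Φ
  /-- the backward intertwiner -/
  invFun : S.IsIntertwiner V' V Ψ
  /-- `Ψ ∘ Φ = id` on `V` -/
  left_inv : ∀ ψ ∈ V, Ψ (Φ ψ) = ψ
  /-- `Φ ∘ Ψ = id` on `V'` -/
  right_inv : ∀ ψ' ∈ V', Φ (Ψ ψ') = ψ'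

/-- `V` and `V'` are ISOMORPHIC representations: some pair of mutually inverse intertwiners exists. -/
def IsoRep (V V' : Set (G → ℂ)) : Prop := ∃ Φ Ψ : (G → ℂ) → (G → ℂ), S.IsIsoRep V V' Φ Ψ

/-- **multiplicity one of a family of constituents**: distinct indices carry NON-isomorphic representations (the
isotypic wording of (C2)'s printed input — the discrete spectrum of `U(W)` is multiplicity free — DISPLAYED). -/
def MultiplicityOne (τ : ℕ → Set (G → ℂ)) : Prop := ∀ m m', m ≠ m' → ¬ S.IsoRep (τ m) (τ m')

variable {S}

omit [IsTopologicalGroup G] [BorelSpace G] in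
/-- the identity is an intertwiner. -/
theorem IsIntertwiner.id (V : Set (G → ℂ)) : S.IsIntertwiner V V id :=
  ⟨fun _ h => h, fun _ _ _ _ => rfl, fun _ _ _ => rfl, fun _ _ _ => rfl, fun _ _ _ _ => rfl⟩

omit [IsTopologicalGroup G] [BorelSpace G] in
/-- intertwiners compose. -/
theorem IsIntertwiner.comp {V V' V'' : Set (G → ℂ)} {Φ Φ' : (G → ℂ) → (G → ℂ)}
    (h : S.IsIntertwiner V V' Φ) (h' : S.IsIntertwiner V' V'' Φ') : S.IsIntertwiner V V'' (Φ' ∘ Φ) where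
  maps ψ hψ := h'.maps _ (h.maps ψ hψ)
  add ψ hψ ψ' hψ' := by
    show Φ' (Φ fun x => ψ x + ψ' x) = fun x => Φ' (Φ ψ) x + Φ' (Φ ψ') x
    rw [h.add ψ hψ ψ' hψ', h'.add _ (h.maps ψ hψ) _ (h.maps ψ' hψ')]
  smul ψ hψ c := by
    show Φ' (Φ fun x => c * ψ x) = fun x => c * Φ' (Φ ψ) x
    rw [h.smul ψ hψ c, h'.smul _ (h.maps ψ hψ) c]
  right ψ hψ g := by
    show Φ' (Φ fun x => ψ (x * g)) = fun x => Φ' (Φ ψ) (x * g)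
    rw [h.right ψ hψ g, h'.right _ (h.maps ψ hψ) g]
  conv ψ hψ f hf := by
    show Φ' (Φ (S.R f ψ)) = S.R f (Φ' (Φ ψ))
    rw [h.conv ψ hψ f hf, h'.conv _ (h.maps ψ hψ) f hf]

omit [IsTopologicalGroup G] [BorelSpace G] in
/-- an isomorphism of representations, read backwards. -/
theorem IsIsoRep.symm {V V' : Set (G → ℂ)} {Φ Ψ : (G → ℂ) → (G → ℂ)} (h : S.IsIsoRep V V' Φ Ψ) :
    S.IsIsoRep V' V Ψ Φ :=
  ⟨h.invFun, h.toFun, h.right_inv, h.left_inv⟩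

omit [IsTopologicalGroup G] [BorelSpace G] in
/-- isomorphisms of representations compose. -/
theorem IsIsoRep.trans {V V' V'' : Set (G → ℂ)} {Φ Ψ Φ' Ψ' : (G → ℂ) → (G → ℂ)} (h : S.IsIsoRep V V' Φ Ψ)
    (h' : S.IsIsoRep V' V'' Φ' Ψ') : S.IsIsoRep V V'' (Φ' ∘ Φ) (Ψ ∘ Ψ') where
  toFun := h.toFun.comp h'.toFun
  invFun := h'.invFun.comp h.invFun
  left_inv ψ hψ := by
    show Ψ (Ψ' (Φ' (Φ ψ))) = ψ
    rw [h'.left_inv _ (h.toFun.maps ψ hψ), h.left_inv ψ hψ]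
  right_inv ψ hψ := by
    show Φ' (Φ (Ψ (Ψ' ψ))) = ψ
    rw [h.right_inv _ (h'.invFun.maps ψ hψ), h'.right_inv ψ hψ]

omit [IsTopologicalGroup G] [BorelSpace G] in
/-- `IsoRep` is reflexive. -/
theorem IsoRep.refl (V : Set (G → ℂ)) : S.IsoRep V V :=
  ⟨id, id, ⟨IsIntertwiner.id V, IsIntertwiner.id V, fun _ _ => rfl, fun _ _ => rfl⟩⟩

omit [IsTopologicalGroup G] [BorelSpace G] in
/-- `IsoRep` is symmetric. -/
theorem IsoRep.symm {V V' : Set (G → ℂ)} (h : S.IsoRep V V') : S.IsoRep V' V := by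
  obtain ⟨Φ, Ψ, h⟩ := h
  exact ⟨Ψ, Φ, h.symm⟩

omit [IsTopologicalGroup G] [BorelSpace G] in
/-- `IsoRep` is transitive. -/
theorem IsoRep.trans {V V' V'' : Set (G → ℂ)} (h : S.IsoRep V V') (h' : S.IsoRep V' V'') : S.IsoRep V V'' := by
  obtain ⟨Φ, Ψ, h⟩ := h
  obtain ⟨Φ', Ψ', h'⟩ := h'
  exact ⟨Φ' ∘ Φ, Ψ ∘ Ψ', h.trans h'⟩

end Intertwiner

section Fixed

variable {H : Type} [Ring H] {ι : Type} {Vb : Submodule ℂ (G → ℂ)} [Module H Vb]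

/-- **the `e`-fixed functor reflects isomorphism on the displayed family** (BERNSTEIN, displayed): an `H`-linear
isomorphism of two fixed blocks `W i ≃ₗ[H] W j` comes from an isomorphism of the constituents
`τ (idx i) ≅ τ (idx j)`. -/
def ReflectsIso (τ : ℕ → Set (G → ℂ)) (idx : ι → ℕ) (W : ι → Submodule H Vb) : Prop :=
  ∀ i j : ι, Nonempty (W i ≃ₗ[H] W j) → S.IsoRep (τ (idx i)) (τ (idx j))

variable {S}

omit [IsTopologicalGroup G] [BorelSpace G] in
/-- multiplicity one of the displayed family forces distinct indices to be distinct constituents. -/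
theorem injective_idx_of_multiplicityOne (τ : ℕ → Set (G → ℂ)) (idx : ι → ℕ)
    (hM : ∀ i j : ι, i ≠ j → ¬ S.IsoRep (τ (idx i)) (τ (idx j))) : Function.Injective idx := by
  intro i j hij
  by_contra hne
  exact hM i j hne (hij ▸ IsoRep.refl (τ (idx i)))

omit [IsTopologicalGroup G] [BorelSpace G] in
/-- `MultiplicityOne τ` restricts to every displayed family with injective indices. -/
theorem multiplicityOne_restrict {τ : ℕ → Set (G → ℂ)} (hM : S.MultiplicityOne τ) {idx : ι → ℕ}
    (hidx : Function.Injective idx) (i j : ι) (hij : i ≠ j) : ¬ S.IsoRep (τ (idx i)) (τ (idx j)) :=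
  hM _ _ (fun h => hij (hidx h))

omit [IsTopologicalGroup G] [BorelSpace G] in
/-- **(C2) from the two displayed clauses**: multiplicity one of the displayed family and the reflection of
isomorphism by the fixed functor give the field `hnon` of p5's block: distinct constituents of the block are
NON-isomorphic `H`-modules. -/
theorem hnon_of_multiplicityOne_of_reflectsIso (τ : ℕ → Set (G → ℂ)) (idx : ι → ℕ) (W : ι → Submodule H Vb)
    (hM : ∀ i j : ι, i ≠ j → ¬ S.IsoRep (τ (idx i)) (τ (idx j))) (hB : S.ReflectsIso τ idx W) :
    ∀ i j : ι, i ≠ j → IsEmpty ((W i) ≃ₗ[H] (W j)) :=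
  fun i j hij => ⟨fun θ => hM i j hij (hB i j ⟨θ⟩)⟩

omit [IsTopologicalGroup G] [BorelSpace G] in
/-- the same, with `MultiplicityOne τ` and the injectivity of the indexing displayed separately. -/
theorem hnon_of_multiplicityOne_of_reflectsIso' (τ : ℕ → Set (G → ℂ)) (idx : ι → ℕ) (W : ι → Submodule H Vb)
    (hM : S.MultiplicityOne τ) (hidx : Function.Injective idx) (hB : S.ReflectsIso τ idx W) :
    ∀ i j : ι, i ≠ j → IsEmpty ((W i) ≃ₗ[H] (W j)) :=
  hnon_of_multiplicityOne_of_reflectsIso τ idx W (multiplicityOne_restrict hM hidx) hB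

variable {e : G → ℂ} {tst : H → G → ℂ} {τ : ℕ → Set (G → ℂ)} {idx : ι → ℕ} {W : ι → Submodule H Vb}
  (he : IsTest e) (hVb : ∀ ψ : G → ℂ, ψ ∈ Vb ↔ S.Invariant ψ ∧ Continuous ψ ∧ S.R e ψ = ψ)
  (htst : ∀ r, IsTest (tst r)) (hact : ∀ (r : H) (ψ : Vb), ((r • ψ : Vb) : G → ℂ) = S.R (tst r) ψ)
  (hinv : ∀ m, S.IsInvariantSubspace (τ m)) (hW : ∀ (i : ι) (ψ : Vb), ψ ∈ W i ↔ (ψ : G → ℂ) ∈ τ (idx i))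

omit [IsTopologicalGroup G] [BorelSpace G] in
include he hVb hinv in
/-- an intertwiner of constituents sends the `e`-fixed part of the source into the block `Vb`. -/
theorem IsIntertwiner.mem_Vb {m m' : ℕ} {Φ : (G → ℂ) → (G → ℂ)} (hΦ : S.IsIntertwiner (τ m) (τ m') Φ)
    {ψ : G → ℂ} (hψ : ψ ∈ Vb) (hψm : ψ ∈ τ m) : Φ ψ ∈ Vb := by
  rw [hVb] at hψ ⊢
  refine ⟨(hinv m').inv _ (hΦ.maps ψ hψm), (hinv m').cont _ (hΦ.maps ψ hψm), ?_⟩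
  rw [← hΦ.conv ψ hψm e he, hψ.2.2]

omit [IsTopologicalGroup G] [BorelSpace G] in
include he hVb hinv hW in
/-- the element of `W j` carried by an intertwiner `τ (idx i) → τ (idx j)` from an element of `W i`. -/
def IsIntertwiner.fixedMap {i j : ι} {Φ : (G → ℂ) → (G → ℂ)} (hΦ : S.IsIntertwiner (τ (idx i)) (τ (idx j)) Φ)
    (w : W i) : W j :=
  ⟨⟨Φ (w : Vb), hΦ.mem_Vb he hVb hinv (w : Vb).2 ((hW i w).1 w.2)⟩, (hW j _).2 (hΦ.maps _ ((hW i w).1 w.2))⟩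

omit [IsTopologicalGroup G] [BorelSpace G] in
include he hVb hinv hW in
/-- the function carried by `fixedMap` (`rfl`). -/
theorem IsIntertwiner.coe_fixedMap {i j : ι} {Φ : (G → ℂ) → (G → ℂ)}
    (hΦ : S.IsIntertwiner (τ (idx i)) (τ (idx j)) Φ) (w : W i) :
    ((hΦ.fixedMap he hVb hinv hW w : W j) : Vb) = Φ (w : Vb) := rfl

omit [IsTopologicalGroup G] [BorelSpace G] in
include he hVb htst hact hinv hW in
/-- **the `e`-fixed functor**: an intertwiner of constituents restricts to an `H`-linear map of the fixed blocks
(the `H`-action is `r • ψ = R (tst r) ψ`, with which every intertwiner commutes). -/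
def IsIntertwiner.fixedLinearMap {i j : ι} {Φ : (G → ℂ) → (G → ℂ)}
    (hΦ : S.IsIntertwiner (τ (idx i)) (τ (idx j)) Φ) : W i →ₗ[H] W j where
  toFun := hΦ.fixedMap he hVb hinv hW
  map_add' w w' := by
    apply Subtype.ext
    apply Subtype.ext
    show Φ ((w : Vb) + (w' : Vb) : Vb) = (Φ (w : Vb) : G → ℂ) + Φ (w' : Vb)
    have h := hΦ.add _ ((hW i w).1 w.2) _ ((hW i w').1 w'.2)
    rw [Submodule.coe_add]
    exact h
  map_smul' r w := by
    apply Subtype.ext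
    apply Subtype.ext
    show Φ ((r • (w : Vb) : Vb) : G → ℂ) = ((r • (hΦ.fixedMap he hVb hinv hW w : W j) : W j) : Vb)
    rw [Submodule.coe_smul, hact r (w : Vb), hact r _, hΦ.coe_fixedMap he hVb hinv hW w]
    exact hΦ.conv _ ((hW i w).1 w.2) _ (htst r)

omit [IsTopologicalGroup G] [BorelSpace G] in
include he hVb htst hact hinv hW in
/-- **the forward functor on isomorphisms**: an isomorphism of constituents `τ (idx i) ≅ τ (idx j)` induces an
`H`-linear isomorphism of the fixed blocks `W i ≃ₗ[H] W j` (the displayed clause `ReflectsIso` is its converse). -/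
theorem exists_linearEquiv_of_isIsoRep {i j : ι} {Φ Ψ : (G → ℂ) → (G → ℂ)}
    (hiso : S.IsIsoRep (τ (idx i)) (τ (idx j)) Φ Ψ) : Nonempty ((W i) ≃ₗ[H] (W j)) := by
  refine ⟨{ hiso.toFun.fixedLinearMap he hVb htst hact hinv hW with
    invFun := hiso.invFun.fixedMap he hVb hinv hW
    left_inv := fun w => ?_
    right_inv := fun w => ?_ }⟩
  · apply Subtype.ext
    apply Subtype.ext
    show Ψ (Φ (w : Vb)) = (w : Vb)
    exact hiso.left_inv _ ((hW i w).1 w.2)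
  · apply Subtype.ext
    apply Subtype.ext
    show Φ (Ψ (w : Vb)) = (w : Vb)
    exact hiso.right_inv _ ((hW j w).1 w.2)

omit [IsTopologicalGroup G] [BorelSpace G] in
include he hVb htst hact hinv hW in
/-- isomorphic constituents have isomorphic fixed blocks. -/
theorem nonempty_linearEquiv_of_isoRep {i j : ι} (h : S.IsoRep (τ (idx i)) (τ (idx j))) :
    Nonempty ((W i) ≃ₗ[H] (W j)) := by
  obtain ⟨Φ, Ψ, hiso⟩ := h
  exact exists_linearEquiv_of_isIsoRep he hVb htst hact hinv hW hiso

omit [IsTopologicalGroup G] [BorelSpace G] in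
include he hVb htst hact hinv hW in
/-- **under `ReflectsIso`, the fixed blocks are isomorphic exactly when the constituents are**. -/
theorem nonempty_linearEquiv_iff_isoRep (hB : S.ReflectsIso τ idx W) (i j : ι) :
    Nonempty ((W i) ≃ₗ[H] (W j)) ↔ S.IsoRep (τ (idx i)) (τ (idx j)) :=
  ⟨hB i j, nonempty_linearEquiv_of_isoRep he hVb htst hact hinv hW⟩

end Fixed

end Setting

end RTF

end Summit.Ventures.HodgeRepro.Tier4.Line1

end
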